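import Summits.QuantumFields.BalabanUV.Beta.D1BFx.LatticeHLSProfiles
import Summits.QuantumFields.BalabanUV.Beta.D1BFx.PackedKernelSplit
import Summits.QuantumFields.BalabanUV.Beta.D1BFx.BlockPairRieszCount

/-!
# `BalabanUV.Beta.D1BFx.ProfileWordCount` — road «BF-x» for binder row D1, slot (K): THE PROFILE WORD-FAMILY LETTER (d1), PART 1 of 2 —
# **THE DAMPED DOUBLE RIESZ COUNT AT BLOCK SCALE, THE TRACE OF A PRODUCT UNDER A JOINT MAJORANT, AND ONE PROFILE LEG AGAINST ONE DENSITY VERTEX**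
# (generic dimension `D`, fibre `F`; PART 2 `ProfileWordFamilies` assembles the two-leg bubble and the tadpole words and their (5.10) families).

WHY (this lineage's `g25/spec/GHOST-N8-SPEC.md` 82550672f4a42f6d §2 (d1); OWNER d1-p2 g23 W-g23-12 l.49928 «GO STATEMENT-FIRST NOW as a generic D1BFx road
letter — second named consumer: PART 24's smooth-word read-outs R-AB ∕ R-BB (chart (α′), an2 R-D1-g44-2)»; gan24-leaf-05 g59 W-1 l.49933 «NOT MINE — GO»):
the landed family letter `GhostWordFamilies.decay510_biBubbleWord_of_decays_bdd_mass` (g18) prices a word by SUP × MASS and stops `n⁵…n⁷` short of the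
`n⁻⁸` a rest needs at the tower weight (N2 v1.2∕v1.3 §2); the currency that reaches it is PROFILE legs (`κ·nrm^{−a}·e^{−(δ∕n)‖·‖∞}`: β2 `GhostLegProfile`,
`GluonLegProfile(D1)`) × DENSITY vertices (per-site sups after one Abel step onto the packing column: leaf-01's L-h `MinimiserColumnGradient`) × the
LATTICE COUNT below — this lineage's g9 HLS kit assembled once in the shape both consumers (ghost rests; tt rests (A,B)∕(B,B)) instantiate BY TERM.

CONTENT (all [folklore]; `‖·‖∞ = PoissonInterior.supNorm` (ℕ-valued), `nrm = max(1, ‖·‖∞)`, `|·|₁ = B12Sec2to5.l1`; block side `n ≥ 1`):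
* §1 tools: `l1_le_mul_supNorm` (`|z|₁ ≤ D·‖z‖∞`), `card_cube` (`#cube c r = (2r+1)^D`), `nrm_le_of_near` ∕ `inv_nrm_pow_le_of_near` (`‖y−z‖∞ ≤ r ⟹
  nrm(x−z) ≤ (r+1)·nrm(x−y)`), `exp_shift_of_near`, `exp_three_le_half` (three dampings whose arguments triangulate `C − C′` pay `e^{−(c∕2)‖C−C′‖∞}` and keep
  the two outer halves), `exp_centres_le` (`e^{−(c∕n)‖n•0 − n•z‖∞} ≤ e^{−(c∕D)|z|₁}` — the n-FREE coarse rate; `BlockPairRieszCount.le_supNorm_zsmul`).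
* §2 THE CORE COUNT **`sum_sum_damped_riesz_le`**: `p ≤ D−1`, `ε > 0`, all finite `S, T`, all centres `C, C′`:
  `Σ_{x∈S} Σ_{z∈T} nrm(x−z)^{−p}·e^{−(ε∕n)‖x−z‖∞}·e^{−(ε∕n)‖z−C‖∞}·e^{−(ε∕n)‖x−C′‖∞} ≤ K_{D,p}(ε)·n^{2D−p}·e^{−(ε∕2n)‖C−C′‖∞}`,
  `K_{D,p}(ε) = 2·(1 + 2D·3^{D−1}·((D−1−p)!·(8∕ε)^{D−1−p}·(1+8∕ε)))·(1 + 2D·3^{D−1}·((D−1)!·(4∕ε)^{D−1}·(1+4∕ε)))` — inner sum by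
  `LatticeHLSProfiles.sum_pow_mul_exp_div_nrm_pow_free_scale_le` (damping centre free, `q = 0`, rate `ε∕2`), outer by `LatticeHLSRadial.sum_pow_mul_exp_scale_le`.
* §3 **`abs_tr_comp_le_of_majorant`** (`|A x z a f| ≤ M₁ x z`, `|B z x f a| ≤ M₂ z x`, all finite double sums of `M₁·M₂` bounded by `Bnd` ⟹ `|tr (A∘B)| ≤ |F|²·Bnd`,
  summability along the way by `LatticeHLSProfiles.summable_and_abs_tsum_le_of_abs_sum_le`) and **`abs_comp_le_of_profile_density`** (`|L x y| ≤ κ·nrm(x−y)^{−p}·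
  e^{−(δ∕n)‖x−y‖∞}`, `|V y z| ≤ A·e^{−(σ∕n)‖z−C‖∞}`, `V y z = 0` unless `‖y−z‖∞ ≤ r` ⟹ `|comp L V x z a f| ≤ |F|·(2r+1)^D·(r+1)^p·e^{δr}·κ·A·nrm(x−z)^{−p}·
  e^{−(δ∕n)‖x−z‖∞}·e^{−(σ∕n)‖z−C‖∞}`).

HONEST DEPENDENCY (cell records, verbatim): «continuum YM on T⁴ ⇐ BetaPertH ∧ nine spine estimates (0/9 proved); BetaPertH ⇐ (D1) ∧ (D4) ∧
CAP+tail; G-an2-4 gates asym, D1 and NE2/3/4.»  HONEST FRAMING (cell contract, verbatim): «discharging `BetaPertH` makes Bałaban's UV stability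
UNCONDITIONAL — a real constructive-QFT result; it is NOT the continuum limit and NOT the Clay problem.»  THIS MODULE DISCHARGES NOTHING of (K), of
D1 or of the wall: [folklore] `ℓ¹`∕lattice-sum bookkeeping over ARBITRARY kernels (an2's `ExpKernelCalculus.comp ∕ tr ∕ tadpole`, leaf-03's
`PackedKernelSplit.biBubble`) with every letter a DISPLAYED `∀`-hypothesis; nothing about Bałaban's operators asserted.  No definition, no `def … : Prop`,
nothing cited, 0 sorry.  0 root-level binders of row D1 discharged (hW ∕ hR-sockets ∕ hSX-socket ∕ D1Tel ∕ D1Rep = 0); (K) NOT closed; NOT D1, NOT `BetaPertH`,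
NOT continuum, NOT Clay.
ABSOLUTE RULE (cell charter, verbatim): «No internally-minted statement may enter as a cited fact. Every hypothesis is either kernel-proved in this
package or a verbatim quotation of a PUBLISHED theorem with page reference. The manuscript(s) under audit are NOT citable for their own disputed
steps — they are the thing under adjudication; programme-internal (2001/route/tribunal) claims are never citable.»
Unit `b2b-balaban-beta-d1-formalise-leaf-04` (gen 25), D1 formalisation swarm leaf prover 04, road «BF-x» (journal [D1LEAF04-G25-INTENT-2]).
-/

noncomputable section

namespace Summit.QuantumFields.BalabanUV.Beta.D1BFx.ProfileWordCount


open Finset Real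
open scoped BigOperators
open Literature.Probability.LatticeModels (Site)
open Literature.MathematicalPhysics.QuantumFieldTheory.Balaban1983to89
open Literature.MathematicalPhysics.QuantumFieldTheory.Balaban1983to89.Beta
open B12Sec2to5 (l1 l1_nonneg Decay510)
open ExpKernelCalculus (MKer comp tr tadpole)
open PoissonInterior (cube mem_cube supNorm nrm supNorm_le_iff natAbs_le_supNorm supNorm_add_le supNorm_neg nrm_pos one_le_nrm supNorm_le_nrm
  mem_cube_iff_supNorm)
open Summit.QuantumFields.BalabanUV.Beta.D1BFx.PackedKernelSplit (biBubble)
open Summit.QuantumFields.BalabanUV.Beta.D1BFx.LatticeHLSRadial (sum_pow_mul_exp_scale_le)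
open Summit.QuantumFields.BalabanUV.Beta.D1BFx.BlockPairRieszCount (le_supNorm_zsmul)
open Summit.QuantumFields.BalabanUV.Beta.D1BFx.LatticeHLSProfiles (sum_pow_mul_exp_div_nrm_pow_free_scale_le summable_and_abs_tsum_le_of_abs_sum_le
  summable_and_tsum_le_of_sum_le)

variable {D : ℕ} {F : Type*} [Fintype F]

/-! ## §1 Tools -/

omit [Fintype F] in
/-- [folklore] `|z|₁ ≤ D·‖z‖∞`. -/
theorem l1_le_mul_supNorm (z : Site D) : l1 z ≤ (D : ℝ) * (supNorm z : ℝ) := by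
  unfold B12Sec2to5.l1
  calc ∑ μ, |((z μ : ℤ) : ℝ)| ≤ ∑ _μ : Fin D, (supNorm z : ℝ) := Finset.sum_le_sum fun μ _ => by
        rw [← Int.cast_abs, Int.abs_eq_natAbs]
        exact_mod_cast natAbs_le_supNorm z μ
    _ = (D : ℝ) * (supNorm z : ℝ) := by rw [Finset.sum_const, Finset.card_univ, Fintype.card_fin, nsmul_eq_mul]

omit [Fintype F] in
/-- [folklore] `#cube c r = (2r+1)^D`. -/
theorem card_cube (c : Site D) (r : ℕ) : (cube c r).card = (2 * r + 1) ^ D := by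
  unfold PoissonInterior.cube
  rw [Fintype.card_piFinset]
  have h : ∀ i : Fin D, (Finset.Icc (c i - r) (c i + r)).card = 2 * r + 1 := fun i => by
    rw [Int.card_Icc]; omega
  rw [Finset.prod_congr rfl fun i _ => h i, Finset.prod_const, Finset.card_univ, Fintype.card_fin]

omit [Fintype F] in
/-- [folklore] **NEAR POINTS SEE THE SAME DISTANCE UP TO `r+1`**: `‖y−z‖∞ ≤ r ⟹ nrm(x−z) ≤ (r+1)·nrm(x−y)`. -/
theorem nrm_le_of_near {x y z : Site D} {r : ℕ} (h : supNorm (y - z) ≤ r) : nrm (x - z) ≤ ((r : ℝ) + 1) * nrm (x - y) := by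
  have h1 : supNorm (x - z) ≤ supNorm (x - y) + supNorm (y - z) := by
    have := supNorm_add_le (x - y) (y - z); rwa [show x - y + (y - z) = x - z by abel] at this
  have h2 : (supNorm (x - z) : ℝ) ≤ (supNorm (x - y) : ℝ) + r := by exact_mod_cast h1.trans (Nat.add_le_add_left h _)
  have h3 := supNorm_le_nrm (x - y)
  have h4 := one_le_nrm (x - y)
  have h5 : (0 : ℝ) ≤ r := Nat.cast_nonneg r
  unfold PoissonInterior.nrm at *
  rcases le_total (1 : ℝ) (supNorm (x - z) : ℝ) with h6 | h6
  · rw [max_eq_right h6]; nlinarith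
  · rw [max_eq_left h6]; nlinarith

omit [Fintype F] in
/-- [folklore] The inverse-power form: `‖y−z‖∞ ≤ r ⟹ nrm(x−y)^{−p} ≤ (r+1)^p·nrm(x−z)^{−p}`. -/
theorem inv_nrm_pow_le_of_near {x y z : Site D} {r : ℕ} (h : supNorm (y - z) ≤ r) (p : ℕ) :
    1 / nrm (x - y) ^ p ≤ ((r : ℝ) + 1) ^ p / nrm (x - z) ^ p := by
  have hz := nrm_pos (x - z)
  have hy := nrm_pos (x - y)
  rw [div_le_div_iff₀ (pow_pos hy p) (pow_pos hz p), one_mul, ← mul_pow]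
  exact pow_le_pow_left₀ hz.le (nrm_le_of_near h) p

omit [Fintype F] in
/-- [folklore] Exponential shift by a near point: `‖y−z‖∞ ≤ r`, `0 ≤ c` ⟹ `e^{−c‖x−y‖∞} ≤ e^{c·r}·e^{−c‖x−z‖∞}` and `e^{−c‖y−w‖∞} ≤ e^{c·r}·e^{−c‖z−w‖∞}`. -/
theorem exp_shift_of_near {x y z w : Site D} {r : ℕ} (h : supNorm (y - z) ≤ r) {c : ℝ} (hc : 0 ≤ c) :
    Real.exp (-c * supNorm (x - y)) ≤ Real.exp (c * r) * Real.exp (-c * supNorm (x - z)) ∧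
    Real.exp (-c * supNorm (y - w)) ≤ Real.exp (c * r) * Real.exp (-c * supNorm (z - w)) := by
  have h1 : supNorm (x - z) ≤ supNorm (x - y) + supNorm (y - z) := by
    have := supNorm_add_le (x - y) (y - z); rwa [show x - y + (y - z) = x - z by abel] at this
  have h2 : supNorm (z - w) ≤ supNorm (y - z) + supNorm (y - w) := by
    have := supNorm_add_le (z - y) (y - w)
    rwa [show z - y + (y - w) = z - w by abel, show z - y = -(y - z) by abel, supNorm_neg] at this
  have h1' : (supNorm (x - z) : ℝ) ≤ supNorm (x - y) + r := by exact_mod_cast h1.trans (Nat.add_le_add_left h _)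
  have h2' : (supNorm (z - w) : ℝ) ≤ r + supNorm (y - w) := by exact_mod_cast h2.trans (Nat.add_le_add_right h _)
  constructor <;> (rw [← Real.exp_add]; apply Real.exp_le_exp.mpr; nlinarith)

omit [Fintype F] in
/-- [folklore] **THREE DAMPINGS TRIANGULATE THE CENTRES**: with `0 ≤ c`, `e^{−c‖x−z‖}·e^{−c‖z−C‖}·e^{−c‖x−C′‖} ≤ e^{−(c∕2)‖C−C′‖}·(e^{−(c∕2)‖z−C‖}·e^{−(c∕2)‖x−C′‖})`
(`‖C−C′‖ ≤ ‖z−C‖ + ‖x−z‖ + ‖x−C′‖`; half of each rate pays the centre distance, the other half stays). -/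
theorem exp_three_le_half {c : ℝ} (hc : 0 ≤ c) (x z C C' : Site D) :
    Real.exp (-c * supNorm (x - z)) * Real.exp (-c * supNorm (z - C)) * Real.exp (-c * supNorm (x - C'))
      ≤ Real.exp (-(c / 2) * supNorm (C - C')) * (Real.exp (-(c / 2) * supNorm (z - C)) * Real.exp (-(c / 2) * supNorm (x - C'))) := by
  have htri : supNorm (C - C') ≤ supNorm (z - C) + supNorm (x - z) + supNorm (x - C') := by
    have h1 := supNorm_add_le (C - z) (z - C')
    have h2 := supNorm_add_le (z - x) (x - C')
    rw [show C - z + (z - C') = C - C' by abel] at h1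
    rw [show z - x + (x - C') = z - C' by abel] at h2
    rw [show C - z = -(z - C) by abel, supNorm_neg] at h1
    rw [show z - x = -(x - z) by abel, supNorm_neg] at h2
    omega
  have htri' : (supNorm (C - C') : ℝ) ≤ supNorm (z - C) + supNorm (x - z) + supNorm (x - C') := by exact_mod_cast htri
  rw [← Real.exp_add, ← Real.exp_add, ← Real.exp_add, ← Real.exp_add]
  apply Real.exp_le_exp.mpr
  have h0 : (0 : ℝ) ≤ supNorm (x - z) := Nat.cast_nonneg _
  nlinarith

omit [Fintype F] in
/-- [folklore] From the centre damping at scale `n` to the (5.10) rate in the COARSE displacement: for `0 ≤ c`,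
`e^{−(c∕n)‖n•0 − n•z‖∞} ≤ e^{−(c∕D)|z|₁}` (`‖n•z‖∞ = n‖z‖∞ ≥ (n∕D)|z|₁`). -/
theorem exp_centres_le (hD : 0 < D) {n : ℕ} (hn : 1 ≤ n) {c : ℝ} (hc : 0 ≤ c) (z : Site D) :
    Real.exp (-(c / n) * supNorm ((n : ℤ) • (0 : Site D) - (n : ℤ) • z)) ≤ Real.exp (-(c / D) * l1 z) := by
  have hn0 : (0 : ℝ) < n := by exact_mod_cast hn
  have hD0 : (0 : ℝ) < D := by exact_mod_cast hD
  rw [smul_zero, zero_sub, supNorm_neg]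
  apply Real.exp_le_exp.mpr
  have h1 : (n : ℝ) * (supNorm z : ℝ) ≤ (supNorm ((n : ℤ) • z) : ℝ) := by exact_mod_cast le_supNorm_zsmul hD n z
  have h2 := l1_le_mul_supNorm z
  have h3 : c / D * l1 z ≤ c * (supNorm z : ℝ) := by
    rw [div_mul_eq_mul_div, div_le_iff₀ hD0]
    calc c * l1 z ≤ c * ((D : ℝ) * (supNorm z : ℝ)) := mul_le_mul_of_nonneg_left h2 hc
      _ = c * (supNorm z : ℝ) * D := by ring
  have h4 : c * (supNorm z : ℝ) ≤ c / n * (supNorm ((n : ℤ) • z) : ℝ) := by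
    rw [div_mul_eq_mul_div, le_div_iff₀ hn0]
    calc c * (supNorm z : ℝ) * n = c * ((n : ℝ) * (supNorm z : ℝ)) := by ring
      _ ≤ c * (supNorm ((n : ℤ) • z) : ℝ) := mul_le_mul_of_nonneg_left h1 hc
  linarith

/-! ## §2 The core count: a damped double Riesz sum at block scale -/

/-- [folklore] **THE DAMPED DOUBLE RIESZ SUM** (sub-critical `p ≤ D−1`; `ε > 0`; `n ≥ 1`; all finite `S, T`; all centres `C, C′`):
`Σ_{x∈S} Σ_{z∈T} nrm(x−z)^{−p}·e^{−(ε∕n)‖x−z‖∞}·e^{−(ε∕n)‖z−C‖∞}·e^{−(ε∕n)‖x−C′‖∞} ≤ K·n^{2D−p}·e^{−(ε∕2n)‖C−C′‖∞}` with the n-FREE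
`K = 2·(1 + 2D·3^{D−1}·((D−1−p)!·(8∕ε)^{D−1−p}·(1+8∕ε))) · (1 + 2D·3^{D−1}·((D−1)!·(4∕ε)^{D−1}·(1+4∕ε)))` (inner: the kit's damping-centre-free scale sum at
rate `ε∕2`, `q = 0`; outer: the kit's damped moment sum, `q = 0`). -/
theorem sum_sum_damped_riesz_le (hD : 0 < D) {ε : ℝ} (hε : 0 < ε) {n : ℕ} (hn : 1 ≤ n) {p : ℕ} (hp : p ≤ D - 1)
    (S T : Finset (Site D)) (C C' : Site D) :
    ∑ x ∈ S, ∑ z ∈ T, 1 / nrm (x - z) ^ p * Real.exp (-(ε / n) * supNorm (x - z)) * Real.exp (-(ε / n) * supNorm (z - C))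
        * Real.exp (-(ε / n) * supNorm (x - C'))
      ≤ (2 * (1 + 2 * D * 3 ^ (D - 1) * ((D - 1 - p).factorial * (8 / ε) ^ (D - 1 - p) * (1 + 8 / ε))))
        * (1 + 2 * D * 3 ^ (D - 1) * ((D - 1).factorial * (4 / ε) ^ (D - 1) * (1 + 4 / ε)))
        * (n : ℝ) ^ (2 * D - p) * Real.exp (-(ε / 2 / n) * supNorm (C - C')) := by
  have hn0 : (0 : ℝ) < n := by exact_mod_cast hn
  have hεn : 0 ≤ ε / n := by positivity
  -- abbreviations for the two kit constants
  set K₁ : ℝ := 2 * (1 + 2 * D * 3 ^ (D - 1) * ((D - 1 - p).factorial * (8 / ε) ^ (D - 1 - p) * (1 + 8 / ε))) with hK₁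
  set K₂ : ℝ := 1 + 2 * D * 3 ^ (D - 1) * ((D - 1).factorial * (4 / ε) ^ (D - 1) * (1 + 4 / ε)) with hK₂
  have hK₁0 : 0 ≤ K₁ := by rw [hK₁]; positivity
  have hK₂0 : 0 ≤ K₂ := by rw [hK₂]; positivity
  -- STEP 1: triangulate the centres (half of each rate)
  have hstep : ∀ x z, 1 / nrm (x - z) ^ p * Real.exp (-(ε / n) * supNorm (x - z)) * Real.exp (-(ε / n) * supNorm (z - C))
        * Real.exp (-(ε / n) * supNorm (x - C'))
      ≤ Real.exp (-(ε / 2 / n) * supNorm (C - C')) *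
        (Real.exp (-(ε / 2 / n) * supNorm (x - C')) * (Real.exp (-(ε / 2 / n) * supNorm (z - C)) / nrm (x - z) ^ p)) := by
    intro x z
    have h := exp_three_le_half hεn x z C C'
    have hq : 0 ≤ 1 / nrm (x - z) ^ p := by have := nrm_pos (x - z); positivity
    have e1 : -(ε / n / 2) = -(ε / 2 / n) := by ring
    rw [e1] at h
    calc 1 / nrm (x - z) ^ p * Real.exp (-(ε / n) * supNorm (x - z)) * Real.exp (-(ε / n) * supNorm (z - C))
          * Real.exp (-(ε / n) * supNorm (x - C'))
        = 1 / nrm (x - z) ^ p * (Real.exp (-(ε / n) * supNorm (x - z)) * Real.exp (-(ε / n) * supNorm (z - C))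
          * Real.exp (-(ε / n) * supNorm (x - C'))) := by ring
      _ ≤ 1 / nrm (x - z) ^ p * (Real.exp (-(ε / 2 / n) * supNorm (C - C')) *
          (Real.exp (-(ε / 2 / n) * supNorm (z - C)) * Real.exp (-(ε / 2 / n) * supNorm (x - C')))) :=
          mul_le_mul_of_nonneg_left h hq
      _ = _ := by ring
  -- STEP 2: inner sum over `z` (damping centre `C`, singularity at `x`), uniform in `x`
  have hinner : ∀ x, ∑ z ∈ T, Real.exp (-(ε / 2 / n) * supNorm (z - C)) / nrm (x - z) ^ p ≤ K₁ * (n : ℝ) ^ (D - p) := by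
    intro x
    have h := sum_pow_mul_exp_div_nrm_pow_free_scale_le hD (δ := ε / 2) (by positivity) hn hp 0 T x C
    simp only [pow_zero, one_mul, Nat.factorial_zero, Nat.cast_one, mul_one, add_zero] at h
    have e8 : (4 : ℝ) / (ε / 2) = 8 / ε := by field_simp; ring
    rw [e8] at h
    refine le_trans (le_of_eq (Finset.sum_congr rfl fun z _ => ?_)) (le_trans h (le_of_eq (by rw [hK₁])))
    rw [PoissonInterior.nrm, show x - z = -(z - x) by abel, supNorm_neg]; rfl
  -- STEP 3: outer sum over `x`
  have houter : ∑ x ∈ S, Real.exp (-(ε / 2 / n) * supNorm (x - C')) ≤ K₂ * (n : ℝ) ^ D := by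
    have h := sum_pow_mul_exp_scale_le hD (δ := ε / 2) (by positivity) hn 0 S C'
    simp only [pow_zero, one_mul, zero_add] at h
    have e4 : (2 : ℝ) / (ε / 2) = 4 / ε := by field_simp; ring
    rw [e4] at h
    have hn1 : (1 : ℝ) ≤ (n : ℝ) ^ D := one_le_pow₀ (by exact_mod_cast hn)
    calc ∑ x ∈ S, Real.exp (-(ε / 2 / n) * supNorm (x - C'))
        ≤ 1 + 2 * D * 3 ^ (D - 1) * ((D - 1).factorial * (4 / ε) ^ (D - 1) * (1 + 4 / ε)) * (n : ℝ) ^ D := by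
          simpa using h
      _ ≤ K₂ * (n : ℝ) ^ D := by
          rw [hK₂, add_mul, one_mul]
          gcongr
  -- assemble
  calc ∑ x ∈ S, ∑ z ∈ T, 1 / nrm (x - z) ^ p * Real.exp (-(ε / n) * supNorm (x - z)) * Real.exp (-(ε / n) * supNorm (z - C))
          * Real.exp (-(ε / n) * supNorm (x - C'))
      ≤ ∑ x ∈ S, ∑ z ∈ T, Real.exp (-(ε / 2 / n) * supNorm (C - C')) *
          (Real.exp (-(ε / 2 / n) * supNorm (x - C')) * (Real.exp (-(ε / 2 / n) * supNorm (z - C)) / nrm (x - z) ^ p)) :=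
        Finset.sum_le_sum fun x _ => Finset.sum_le_sum fun z _ => hstep x z
    _ = Real.exp (-(ε / 2 / n) * supNorm (C - C')) *
          ∑ x ∈ S, Real.exp (-(ε / 2 / n) * supNorm (x - C')) * ∑ z ∈ T, Real.exp (-(ε / 2 / n) * supNorm (z - C)) / nrm (x - z) ^ p := by
        rw [Finset.mul_sum]; refine Finset.sum_congr rfl fun x _ => ?_; rw [Finset.mul_sum, Finset.mul_sum]
    _ ≤ Real.exp (-(ε / 2 / n) * supNorm (C - C')) * ∑ x ∈ S, Real.exp (-(ε / 2 / n) * supNorm (x - C')) * (K₁ * (n : ℝ) ^ (D - p)) := by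
        gcongr with x _
        exact hinner x
    _ = Real.exp (-(ε / 2 / n) * supNorm (C - C')) * (K₁ * (n : ℝ) ^ (D - p)) * ∑ x ∈ S, Real.exp (-(ε / 2 / n) * supNorm (x - C')) := by
        rw [← Finset.sum_mul]; ring
    _ ≤ Real.exp (-(ε / 2 / n) * supNorm (C - C')) * (K₁ * (n : ℝ) ^ (D - p)) * (K₂ * (n : ℝ) ^ D) := by
        gcongr
    _ = K₁ * K₂ * ((n : ℝ) ^ (D - p) * (n : ℝ) ^ D) * Real.exp (-(ε / 2 / n) * supNorm (C - C')) := by ring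
    _ = K₁ * K₂ * (n : ℝ) ^ (2 * D - p) * Real.exp (-(ε / 2 / n) * supNorm (C - C')) := by
        rw [← pow_add]; congr 3; omega

/-! ## §3 A trace bound from a kernel majorant, and one profile leg against one density vertex -/

/-- [folklore] **TRACE OF A PRODUCT UNDER A JOINT MAJORANT WITH BOUNDED DOUBLE SUMS**: if `|A x z a f| ≤ M₁ x z` and `|B z x f a| ≤ M₂ z x`
(uniform in the fibre indices, `M₁, M₂ ≥ 0`) and every finite double sum `Σ_{x∈S} Σ_{z∈T} M₁ x z·M₂ z x ≤ Bnd`, then `|tr (comp A B)| ≤ |F|²·Bnd`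
(the `z`-sums and the `x`-sum are summable along the way — `LatticeHLSProfiles.summable_and_abs_tsum_le_of_abs_sum_le`). -/
theorem abs_tr_comp_le_of_majorant {A B : MKer D F} {M₁ M₂ : Site D → Site D → ℝ} {Bnd : ℝ}
    (hA : ∀ x z a f, |A x z a f| ≤ M₁ x z) (hB : ∀ z x f a, |B z x f a| ≤ M₂ z x)
    (hM₁ : ∀ x z, 0 ≤ M₁ x z) (hM₂ : ∀ z x, 0 ≤ M₂ z x)
    (hBnd : ∀ S T : Finset (Site D), ∑ x ∈ S, ∑ z ∈ T, M₁ x z * M₂ z x ≤ Bnd) :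
    |tr (comp A B)| ≤ (Fintype.card F : ℝ) ^ 2 * Bnd := by
  -- the row functions `Φ x := z ↦ M₁ x z · M₂ z x` are summable with `Σ_{x∈S} Σ'_z Φ x z ≤ Bnd`
  have hΦnn : ∀ x z, 0 ≤ M₁ x z * M₂ z x := fun x z => mul_nonneg (hM₁ x z) (hM₂ z x)
  have hΦs : ∀ x, Summable fun z => M₁ x z * M₂ z x := fun x =>
    summable_of_sum_le (hΦnn x) fun T => by simpa using hBnd {x} T
  have hrows : ∀ S : Finset (Site D), ∑ x ∈ S, ∑' z, M₁ x z * M₂ z x ≤ Bnd := by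
    intro S
    rw [← Summable.tsum_finsetSum (fun x _ => hΦs x)]
    refine Real.tsum_le_of_sum_le (fun z => Finset.sum_nonneg fun x _ => hΦnn x z) fun T => ?_
    rw [Finset.sum_comm]; exact hBnd S T
  have hBnd0 : 0 ≤ Bnd := le_trans (by simp) (hBnd ∅ ∅)
  -- inner: the `z`-sum at fixed `x, a`
  have hinner : ∀ x a, |comp A B x x a a| ≤ (Fintype.card F : ℝ) * ∑' z, M₁ x z * M₂ z x := by
    intro x a
    unfold ExpKernelCalculus.comp
    refine (summable_and_abs_tsum_le_of_abs_sum_le fun T => ?_).2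
    calc ∑ z ∈ T, |∑ f, A x z a f * B z x f a| ≤ ∑ z ∈ T, ∑ f, M₁ x z * M₂ z x :=
          Finset.sum_le_sum fun z _ => (Finset.abs_sum_le_sum_abs _ _).trans (Finset.sum_le_sum fun f _ => by
            rw [abs_mul]; exact mul_le_mul (hA x z a f) (hB z x f a) (abs_nonneg _) (hM₁ x z))
      _ = (Fintype.card F : ℝ) * ∑ z ∈ T, M₁ x z * M₂ z x := by
          rw [Finset.mul_sum]; refine Finset.sum_congr rfl fun z _ => ?_
          rw [Finset.sum_const, Finset.card_univ, nsmul_eq_mul]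
      _ ≤ (Fintype.card F : ℝ) * ∑' z, M₁ x z * M₂ z x :=
          mul_le_mul_of_nonneg_left ((hΦs x).sum_le_tsum T fun z _ => hΦnn x z) (Nat.cast_nonneg _)
  -- outer: the `x`-sum
  unfold ExpKernelCalculus.tr
  refine (summable_and_abs_tsum_le_of_abs_sum_le fun S => ?_).2
  calc ∑ x ∈ S, |∑ a, comp A B x x a a| ≤ ∑ x ∈ S, ∑ a : F, (Fintype.card F : ℝ) * ∑' z, M₁ x z * M₂ z x :=
        Finset.sum_le_sum fun x _ => (Finset.abs_sum_le_sum_abs _ _).trans (Finset.sum_le_sum fun a _ => hinner x a)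
    _ = (Fintype.card F : ℝ) ^ 2 * ∑ x ∈ S, ∑' z, M₁ x z * M₂ z x := by
        rw [Finset.mul_sum]; refine Finset.sum_congr rfl fun x _ => ?_
        rw [Finset.sum_const, Finset.card_univ, nsmul_eq_mul]; ring
    _ ≤ (Fintype.card F : ℝ) ^ 2 * Bnd := mul_le_mul_of_nonneg_left (hrows S) (by positivity)

/-- [folklore] **ONE PROFILE LEG AGAINST ONE FINITE-RANGE DENSITY VERTEX**: `|L x y| ≤ κ·nrm(x−y)^{−p}·e^{−(δ∕n)‖x−y‖∞}`, `|V y z| ≤ A·e^{−(σ∕n)‖z−C‖∞}`,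
`V y z = 0` unless `‖y−z‖∞ ≤ r` (`κ, A, δ ≥ 0`, `n ≥ 1`) ⟹
`|comp L V x z a f| ≤ |F|·(2r+1)^D·(r+1)^p·e^{δr}·κ·A · nrm(x−z)^{−p}·e^{−(δ∕n)‖x−z‖∞}·e^{−(σ∕n)‖z−C‖∞}` — the `y`-sum lives in `cube z r`, where the leg's
profile and damping are those at `z` up to the displayed `r`-factors. -/
theorem abs_comp_le_of_profile_density {n : ℕ} (hn : 1 ≤ n) {L V : MKer D F} {κ A δ σ : ℝ} {p r : ℕ} {C : Site D}
    (hκ : 0 ≤ κ) (hA : 0 ≤ A) (hδ : 0 ≤ δ)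
    (hL : ∀ x y a b, |L x y a b| ≤ κ / nrm (x - y) ^ p * Real.exp (-(δ / n) * supNorm (x - y)))
    (hVb : ∀ y z g f, |V y z g f| ≤ A * Real.exp (-(σ / n) * supNorm (z - C)))
    (hVr : ∀ y z g f, r < supNorm (y - z) → V y z g f = 0)
    (x z : Site D) (a f : F) :
    |comp L V x z a f| ≤ (Fintype.card F : ℝ) * (2 * r + 1) ^ D * ((r : ℝ) + 1) ^ p * Real.exp (δ * r) * κ * A
        * (1 / nrm (x - z) ^ p * Real.exp (-(δ / n) * supNorm (x - z)) * Real.exp (-(σ / n) * supNorm (z - C))) := by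
  classical
  have hn0 : (0 : ℝ) < n := by exact_mod_cast hn
  have hδn : 0 ≤ δ / n := by positivity
  -- the pointwise bound on the `y`-terms inside the cube, zero outside
  set M : ℝ := (Fintype.card F : ℝ) * (((r : ℝ) + 1) ^ p * Real.exp (δ * r) * κ * A
        * (1 / nrm (x - z) ^ p * Real.exp (-(δ / n) * supNorm (x - z)) * Real.exp (-(σ / n) * supNorm (z - C)))) with hM
  have hM0 : 0 ≤ M := by rw [hM]; have := nrm_pos (x - z); positivity
  have hterm : ∀ y, |∑ g, L x y a g * V y z g f| ≤ if supNorm (y - z) ≤ r then M else 0 := by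
    intro y
    split_ifs with hy
    · calc |∑ g, L x y a g * V y z g f| ≤ ∑ g, |L x y a g| * |V y z g f| :=
            (Finset.abs_sum_le_sum_abs _ _).trans (le_of_eq (Finset.sum_congr rfl fun g _ => abs_mul _ _))
        _ ≤ ∑ _g : F, (κ / nrm (x - y) ^ p * Real.exp (-(δ / n) * supNorm (x - y))) * (A * Real.exp (-(σ / n) * supNorm (z - C))) :=
            Finset.sum_le_sum fun g _ => mul_le_mul (hL x y a g) (hVb y z g f) (abs_nonneg _)
              (by have := nrm_pos (x - y); positivity)
        _ = (Fintype.card F : ℝ) * ((κ / nrm (x - y) ^ p * Real.exp (-(δ / n) * supNorm (x - y))) * (A * Real.exp (-(σ / n) * supNorm (z - C)))) := by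
            rw [Finset.sum_const, Finset.card_univ, nsmul_eq_mul]
        _ ≤ M := by
            rw [hM]
            refine mul_le_mul_of_nonneg_left ?_ (Nat.cast_nonneg _)
            have h1 := inv_nrm_pow_le_of_near (x := x) hy p
            have h2 := (exp_shift_of_near (x := x) (w := C) hy hδn).1
            have h3 : Real.exp (δ / n * r) ≤ Real.exp (δ * r) := Real.exp_le_exp.mpr (by
              rw [div_mul_eq_mul_div]; exact div_le_self (by positivity) (by exact_mod_cast hn))
            have hq : 0 ≤ Real.exp (-(δ / n) * supNorm (x - z)) := (Real.exp_pos _).le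
            have hq' : 0 ≤ A * Real.exp (-(σ / n) * supNorm (z - C)) := by positivity
            have step : κ * (1 / nrm (x - y) ^ p) * Real.exp (-(δ / n) * supNorm (x - y))
                ≤ κ * (((r : ℝ) + 1) ^ p / nrm (x - z) ^ p) * (Real.exp (δ * r) * Real.exp (-(δ / n) * supNorm (x - z))) :=
              mul_le_mul (mul_le_mul_of_nonneg_left h1 hκ) (h2.trans (mul_le_mul_of_nonneg_right h3 hq)) (Real.exp_pos _).le
                (by have := nrm_pos (x - z); positivity)
            calc κ / nrm (x - y) ^ p * Real.exp (-(δ / n) * supNorm (x - y)) * (A * Real.exp (-(σ / n) * supNorm (z - C)))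
                = κ * (1 / nrm (x - y) ^ p) * Real.exp (-(δ / n) * supNorm (x - y)) * (A * Real.exp (-(σ / n) * supNorm (z - C))) := by ring
              _ ≤ κ * (((r : ℝ) + 1) ^ p / nrm (x - z) ^ p) * (Real.exp (δ * r) * Real.exp (-(δ / n) * supNorm (x - z)))
                  * (A * Real.exp (-(σ / n) * supNorm (z - C))) := mul_le_mul_of_nonneg_right step hq'
              _ = _ := by ring
    · -- outside the cube every term vanishes
      rw [not_le] at hy
      simp [hVr _ _ _ _ hy]
  -- sum over `y`: at most `#cube z r` nonzero terms, each `≤ M`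
  unfold ExpKernelCalculus.comp
  refine le_trans (summable_and_abs_tsum_le_of_abs_sum_le (C := ((cube z r).card : ℝ) * M) fun S => ?_).2 (le_of_eq ?_)
  · calc ∑ y ∈ S, |∑ g, L x y a g * V y z g f| ≤ ∑ y ∈ S, (if supNorm (y - z) ≤ r then M else 0) := Finset.sum_le_sum fun y _ => hterm y
      _ = ∑ y ∈ S.filter (fun y => supNorm (y - z) ≤ r), M := by rw [Finset.sum_filter]
      _ = ((S.filter (fun y => supNorm (y - z) ≤ r)).card : ℝ) * M := by rw [Finset.sum_const, nsmul_eq_mul]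
      _ ≤ ((cube z r).card : ℝ) * M := by
          refine mul_le_mul_of_nonneg_right ?_ hM0
          exact_mod_cast Finset.card_le_card fun y hy => mem_cube_iff_supNorm.mpr (Finset.mem_filter.mp hy).2
  · rw [card_cube, hM]; push_cast; ring


end Summit.QuantumFields.BalabanUV.Beta.D1BFx.ProfileWordCount

end
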